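import Literature.Geometry.Lorentzian.KerrDeSitter
import Literature.Geometry.Lorentzian.KerrData
import Literature.Geometry.Lorentzian.KerrDataSchwarzschildMetric
import HarnessLib

/-!
# Kerr–de Sitter initial data on the horizon-crossing slice `{t* = 0}`

Family `gr`; definition request `defn-KerrDeSitterData` of route
`route-FinalStateConjecture-LambdaRegulator` (item `UniformKdSCapture`, stmt-FinalStateConjecture-10110).

In the Cartesian star-chart of `KerrDeSitter.lean` (coordinates `(t*, x, y, z)` on
`Kerr.region a r₀ ⊆ E4`, regular across the future event **and** the future cosmological horizon,
equal to the ingoing Kerr–Schild chart at `Λ = 0`) the hypersurface `{t* = 0} ∩ {r > max r₀ 0}` is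
identified with the open subset `Kerr.slice a r₀ = {y ∈ E3 | max r₀ 0 < r(a, (0, y))}` of `E3` — the
**same** open set as for Kerr (`KerrData.lean`), since the Cartesian coordinates and the radius
function `Kerr.radius a` are shared. For regular parameters (`KerrDeSitter.IsRegular M a Λ r₀`) it is
spacelike (its unit normal squared is `ρ² g^{t*t*} = −Q + Ξ²a² sin²θ/Δ_θ < 0`, Petersen–Vasy
arXiv:2112.01355, Remark 1.1), it crosses `𝓗⁺` for `r₀ < r₊` and reaches across `𝓒⁺` into the
expanding region up to the conformal boundary (Hintz–Vasy 2018, §3.2–3.3, Figure 3; the slices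
`{t* = c}` there are its truncations `r₋-ish < r < r_c + ε`), and it carries the induced data
`h = ι^* g`, `k = K_ν` (second fundamental form w.r.t. the future unit normal `ν = T/√(T⁰)`,
`T = −g♯(dt*)`, sign convention (h): `K_ν(v, w) = +g(D_v ν, dι w)`), which solve the `Λ`-vacuum
constraints `R(h) − |k|² + (tr k)² = 2Λ`, `div k − d tr k = 0` (Gauss–Codazzi for a slice of an
Einstein metric `Ric = Λ g`).

## Contents (namespace `Literature.Geometry.Lorentzian.KerrDeSitter`)

* the frame `vecW = (r²+a²)∂_{t*} + a∂_{φ*}`, `vecR = ∂_r`, `vecV = a sin²θ ∂_{t*} + ∂_{φ*}` of the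
  star chart with its evaluation and frame lemmas (`bilin_vecW`, `bilin_vecR`, `bilin_vecV`), and
  the **discharge `bilin_timeVector_holds`** of the named fact `KerrDeSitter.bilin_timeVector` of
  `KerrDeSitter.lean` (`g(T, ·) = −dt*`, proved from the quartic of the Kerr–Schild radius and
  `f² + q̂Δ_r = 1`);
* `KerrDeSitter.slice a r₀` (an `abbrev` for `Kerr.slice a r₀`), `smoothMetric` (the metric at
  regularity `∞`), `sliceNormal`, `sliceK`;
* proved: `timeVector_apply_zero_pos` (`T⁰ > 0`), `isSpacelikeImmersion_sliceEmbed` (the slice is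
  spacelike: `(0, v) ⊥ T`, Lorentzian signature) and `isFutureUnitNormal_sliceNormal` (`ν = T/√T⁰`
  is the future unit normal) — theorems, not facts, thanks to `bilin_timeVector_holds`;
* the `Prop`-class `KerrDeSitter.SliceFacts` of named facts (D-0014; house pattern
  `Kerr.SliceFacts`): existence of the Levi-Civita connection of `smoothMetric` (generic fact
  `isCovariantDerivativeOn_leviCivitaFun`), symmetry and smoothness of `k`; the pullback-smoothness
  and connectedness facts are those of `Kerr.SliceFacts` (same region, same slice);
* **`KerrDeSitter.data M a Λ r₀ h : InitialDataSet 𝓘(ℝ, E3) (KerrDeSitter.slice a r₀)`**, the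
  named fact `data_isConstraintSolution` (Hamiltonian constraint `= 2Λ`, momentum constraint `= 0`);
* `Λ = 0`: `smoothMetric M a 0 r₀ h = Kerr.smoothMetric M a r₀`, `sliceNormal M a 0 r₀ = Kerr.sliceNormal M a r₀`
  (proved), so that these data extend `Kerr.data` (same slice, same `h`, same normal).

The capture distance `InitialDataSet.dataWeightedSobolevEDistΛ s δ Λ D (KerrDeSitter.data …)` is in
`WeightedNormsLambda.lean`.

## Design choices

* Hypotheses: the semialgebraic regularity predicate `h : IsRegular M a Λ r₀` of `KerrDeSitter.lean`
  (it contains `0 ≤ Λ` and replaces Kerr's `0 ≤ M`; `isRegular_zero_lambda`), and the instance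
  hypotheses `[KerrDeSitter.Facts]` (analyticity/signature of the chart), `[Kerr.SliceFacts]`
  (connectedness of the slice, smoothness of pullbacks) and `[KerrDeSitter.SliceFacts]`.
* As for Kerr (review F5 of `KerrData.lean`), the slice is **not** a Cauchy hypersurface of
  `Kerr.region a r₀`; statements use developments of the data. Unlike the compact slices of
  Hintz–Vasy/Fang it is unbounded (it reaches the conformal boundary of the cosmological region);
  their `Σ₀` is `{t* = 0, r ≤ r_c + ε}` inside it.
* The normalisation of the unit normal uses `T⁰ = (Q − Ξ²a² sin²θ/Δ_θ)/ρ² = −g(T, T)` (by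
  `g(T, ·) = −dt*`), a manifestly positive-under-`IsRegular` function; junk (`Real.sqrt`, `0⁻¹ = 0`)
  elsewhere.

## References

* B. Carter, Comm. Math. Phys. 10 (1968) 280–310 (the metrics, `Ric = Λ g`).
* P. Hintz, A. Vasy, Acta Math. 220 (2018), §3.2–3.5 (star coordinates, the slices `Σ_{t*}`,
  geometric initial data `(h, k)` and the constraints with `Λ`, (2.3)–(2.4) and §3.5).
* O. Petersen, A. Vasy, arXiv:2112.01355, §1.1, Remark 1.1 (spacelike `t*`-slices).
* A. J. Fang, arXiv:2112.07183 (initial data on `Σ₀` for slowly rotating Kerr–de Sitter).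
* Y. Choquet-Bruhat, *General Relativity and the Einstein Equations* (2009), Ch. VI, Thm. 3.3 and
  Ch. VII (constraints with cosmological constant).
* G. B. Cook, Living Rev. Relativ. 3 (2000) 5, §3.2.2 (the `Λ = 0` Kerr–Schild slice data).
-/

noncomputable section

open Bundle TopologicalSpace Manifold
open scoped ContDiff Topology

namespace Literature.Geometry.Lorentzian

namespace KerrDeSitter

/-! ### The frame `W`, `∂_r`, `V₃` and the discharge of `KerrDeSitter.bilin_timeVector` -/

section Frame

/-- The defining quartic of the Kerr–Schild radius in the form
`r²(x² + y²) = (r² + a²)(r² − z²)` (Visser arXiv:0706.0622, (35)). [cite: arXiv07060622, (35)] -/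
theorem radius_sq_mul_add_sq (a : ℝ) (x : E4) :
    Kerr.radius a x ^ 2 * (x 1 ^ 2 + x 2 ^ 2) =
      (Kerr.radius a x ^ 2 + a ^ 2) * (Kerr.radius a x ^ 2 - x 3 ^ 2) := by
  have hq := Kerr.radius_quartic a x
  rw [E4.spatialNorm_sq] at hq
  linear_combination (-1 : ℝ) * hq

/-- `x² + y² = (r² + a²) sin²θ` wherever `r > 0` (the quartic divided by `r²`;
Visser arXiv:0706.0622, (35)). [cite: arXiv07060622, (35)] -/
theorem sq_add_sq_eq_sinSq (a : ℝ) {x : E4} (hx : 0 < Kerr.radius a x) :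
    x 1 ^ 2 + x 2 ^ 2 = (Kerr.radius a x ^ 2 + a ^ 2) * sinSq a x := by
  have hr : Kerr.radius a x ≠ 0 := hx.ne'
  have h := radius_sq_mul_add_sq a x
  unfold sinSq
  field_simp
  linear_combination h

/-- The vector `W = (r² + a²)∂_{t*} + a ∂_{φ*} = (r² + a², −a y, a x, 0)` (the non-radial part of
the principal null directions; Hintz–Vasy 2018, (3.14)). [cite: HintzVasy2018, §3.2 (3.14)] -/
def vecW (a : ℝ) (x : E4) : E4 :=
  WithLp.toLp 2 ![Kerr.radius a x ^ 2 + a ^ 2, -(a * x 2), a * x 1, 0]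

/-- The coordinate vector `∂_r = (0, r x/(r²+a²), r y/(r²+a²), z/r)` of the star chart
(`x + iy = √(r²+a²) sin θ e^{iφ*}`, `z = r cos θ`). Hintz–Vasy 2018, §3.2. [cite: HintzVasy2018, §3.2] -/
def vecR (a : ℝ) (x : E4) : E4 :=
  WithLp.toLp 2 ![0, Kerr.radius a x * x 1 / (Kerr.radius a x ^ 2 + a ^ 2),
    Kerr.radius a x * x 2 / (Kerr.radius a x ^ 2 + a ^ 2), x 3 / Kerr.radius a x]

/-- The vector `V₃ = a sin²θ ∂_{t*} + ∂_{φ*} = (a sin²θ, −y, x, 0)` (Hintz–Vasy 2018, (3.14)). [cite: HintzVasy2018, §3.2 (3.14)] -/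
def vecV (a : ℝ) (x : E4) : E4 := WithLp.toLp 2 ![a * sinSq a x, -(x 2), x 1, 0]

/-- Components of `W`. [folklore] -/
theorem vecW_apply (a : ℝ) (x : E4) :
    vecW a x 0 = Kerr.radius a x ^ 2 + a ^ 2 ∧ vecW a x 1 = -(a * x 2) ∧ vecW a x 2 = a * x 1 ∧
      vecW a x 3 = 0 :=
  ⟨rfl, rfl, rfl, rfl⟩

/-- Components of `∂_r`. [folklore] -/
theorem vecR_apply (a : ℝ) (x : E4) :
    vecR a x 0 = 0 ∧ vecR a x 1 = Kerr.radius a x * x 1 / (Kerr.radius a x ^ 2 + a ^ 2) ∧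
      vecR a x 2 = Kerr.radius a x * x 2 / (Kerr.radius a x ^ 2 + a ^ 2) ∧
      vecR a x 3 = x 3 / Kerr.radius a x :=
  ⟨rfl, rfl, rfl, rfl⟩

/-- Components of `V₃`. [folklore] -/
theorem vecV_apply (a : ℝ) (x : E4) :
    vecV a x 0 = a * sinSq a x ∧ vecV a x 1 = -(x 2) ∧ vecV a x 2 = x 1 ∧ vecV a x 3 = 0 :=
  ⟨rfl, rfl, rfl, rfl⟩

/-- `ω(W) = ρ²` (uses the quartic). [folklore] -/
theorem omegaCovector_vecW (a : ℝ) {x : E4} (hx : 0 < Kerr.radius a x) :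
    omegaCovector a x (vecW a x) = rhoSq a x := by
  have hra : Kerr.radius a x ^ 2 + a ^ 2 ≠ 0 := by positivity
  have h := sq_add_sq_eq_sinSq a hx
  have h1 : omegaCovector a x (vecW a x) =
      Kerr.radius a x ^ 2 + a ^ 2 - a ^ 2 / (Kerr.radius a x ^ 2 + a ^ 2) * (x 1 ^ 2 + x 2 ^ 2) := by
    rw [omegaCovector_apply, (vecW_apply a x).1, (vecW_apply a x).2.1, (vecW_apply a x).2.2.1]
    ring
  rw [h1, h]
  unfold rhoSq sinSq
  field_simp
  ring

/-- `dr(W) = 0`. [folklore] -/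
theorem drCovector_vecW (a : ℝ) (x : E4) : drCovector a x (vecW a x) = 0 := by
  rw [drCovector_apply, (vecW_apply a x).2.1, (vecW_apply a x).2.2.1, (vecW_apply a x).2.2.2]
  ring

/-- `σ(W) = a (r² + a²) sin²θ` (uses the quartic). [folklore] -/
theorem sigma_vecW (a : ℝ) {x : E4} (hx : 0 < Kerr.radius a x) :
    E4.sigma x (vecW a x) = a * (Kerr.radius a x ^ 2 + a ^ 2) * sinSq a x := by
  have h := sq_add_sq_eq_sinSq a hx
  have h1 : E4.sigma x (vecW a x) = a * (x 1 ^ 2 + x 2 ^ 2) := by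
    rw [E4.sigma_apply, (vecW_apply a x).2.1, (vecW_apply a x).2.2.1]
    ring
  rw [h1, h]
  ring

/-- `δ(W, w) = a σ(w)`. [folklore] -/
theorem spatialDelta_vecW (a : ℝ) (x w : E4) : E4.spatialDelta (vecW a x) w = a * E4.sigma x w := by
  rw [E4.spatialDelta_apply, Fin.sum_univ_three, E4.sigma_apply]
  simp only [Fin.succ_zero_eq_one, Fin.succ_one_eq_two, Fin.reduceSucc]
  rw [(vecW_apply a x).2.1, (vecW_apply a x).2.2.1, (vecW_apply a x).2.2.2]
  ring

/-- `ω(∂_r) = 0`. [folklore] -/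
theorem omegaCovector_vecR (a : ℝ) (x : E4) : omegaCovector a x (vecR a x) = 0 := by
  rw [omegaCovector_apply, (vecR_apply a x).1, (vecR_apply a x).2.1, (vecR_apply a x).2.2.1]
  ring

/-- `dr(∂_r) = 1` (uses the quartic). [folklore] -/
theorem drCovector_vecR (a : ℝ) {x : E4} (hx : 0 < Kerr.radius a x) :
    drCovector a x (vecR a x) = 1 := by
  have hr : Kerr.radius a x ≠ 0 := hx.ne'
  have hra : Kerr.radius a x ^ 2 + a ^ 2 ≠ 0 := by positivity
  have hρ : rhoSq a x ≠ 0 := (rhoSq_pos a hx).ne'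
  have h := sq_add_sq_eq_sinSq a hx
  have h1 : drCovector a x (vecR a x) =
      (Kerr.radius a x ^ 2 / (Kerr.radius a x ^ 2 + a ^ 2) * (x 1 ^ 2 + x 2 ^ 2) +
        (Kerr.radius a x ^ 2 + a ^ 2) * x 3 ^ 2 / Kerr.radius a x ^ 2) / rhoSq a x := by
    rw [drCovector_apply, (vecR_apply a x).2.1, (vecR_apply a x).2.2.1, (vecR_apply a x).2.2.2]
    field_simp
  rw [h1, h]
  unfold rhoSq sinSq at *
  field_simp
  ring

/-- `σ(∂_r) = 0`. [folklore] -/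
theorem sigma_vecR (a : ℝ) (x : E4) : E4.sigma x (vecR a x) = 0 := by
  rw [E4.sigma_apply, (vecR_apply a x).2.1, (vecR_apply a x).2.2.1]
  ring

/-- `δ(∂_r, w) = (ρ²/(r² + a²)) dr(w)` (no quartic needed). [folklore] -/
theorem spatialDelta_vecR (a : ℝ) {x : E4} (hx : 0 < Kerr.radius a x) (w : E4) :
    E4.spatialDelta (vecR a x) w = rhoSq a x / (Kerr.radius a x ^ 2 + a ^ 2) * drCovector a x w := by
  have hr : Kerr.radius a x ≠ 0 := hx.ne'
  have hra : Kerr.radius a x ^ 2 + a ^ 2 ≠ 0 := by positivity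
  have hρ : rhoSq a x ≠ 0 := (rhoSq_pos a hx).ne'
  rw [E4.spatialDelta_apply, Fin.sum_univ_three, drCovector_apply]
  simp only [Fin.succ_zero_eq_one, Fin.succ_one_eq_two, Fin.reduceSucc]
  rw [(vecR_apply a x).2.1, (vecR_apply a x).2.2.1, (vecR_apply a x).2.2.2]
  field_simp

/-- `ω(V₃) = 0` (uses the quartic). [folklore] -/
theorem omegaCovector_vecV (a : ℝ) {x : E4} (hx : 0 < Kerr.radius a x) :
    omegaCovector a x (vecV a x) = 0 := by
  have hra : Kerr.radius a x ^ 2 + a ^ 2 ≠ 0 := by positivity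
  have h := sq_add_sq_eq_sinSq a hx
  have h1 : omegaCovector a x (vecV a x) =
      a * sinSq a x - a / (Kerr.radius a x ^ 2 + a ^ 2) * (x 1 ^ 2 + x 2 ^ 2) := by
    rw [omegaCovector_apply, (vecV_apply a x).1, (vecV_apply a x).2.1, (vecV_apply a x).2.2.1]
    ring
  rw [h1, h]
  field_simp
  ring

/-- `dr(V₃) = 0`. [folklore] -/
theorem drCovector_vecV (a : ℝ) (x : E4) : drCovector a x (vecV a x) = 0 := by
  rw [drCovector_apply, (vecV_apply a x).2.1, (vecV_apply a x).2.2.1, (vecV_apply a x).2.2.2]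
  ring

/-- `σ(V₃) = (r² + a²) sin²θ` (uses the quartic). [folklore] -/
theorem sigma_vecV (a : ℝ) {x : E4} (hx : 0 < Kerr.radius a x) :
    E4.sigma x (vecV a x) = (Kerr.radius a x ^ 2 + a ^ 2) * sinSq a x := by
  have h := sq_add_sq_eq_sinSq a hx
  have h1 : E4.sigma x (vecV a x) = x 1 ^ 2 + x 2 ^ 2 := by
    rw [E4.sigma_apply, (vecV_apply a x).2.1, (vecV_apply a x).2.2.1]
    ring
  rw [h1, h]

/-- `δ(V₃, w) = σ(w)`. [folklore] -/
theorem spatialDelta_vecV (a : ℝ) (x w : E4) : E4.spatialDelta (vecV a x) w = E4.sigma x w := by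
  rw [E4.spatialDelta_apply, Fin.sum_univ_three, E4.sigma_apply]
  simp only [Fin.succ_zero_eq_one, Fin.succ_one_eq_two, Fin.reduceSucc]
  rw [(vecV_apply a x).2.1, (vecV_apply a x).2.2.1, (vecV_apply a x).2.2.2]
  ring

/-- **Frame lemma** `g(W, w) = −(Δ_r/Ξ²) ω(w) − (f ρ²/Ξ) dr(w)` (`Λ ≥ 0`, `r > 0`): `W` is
orthogonal to the angular part (`S(W, ·) = 0`, the `c_σ`-identity). Hintz–Vasy 2018, (3.13)–(3.14). [cite: HintzVasy2018, §3.2 (3.14)] -/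
theorem bilin_vecW (M a : ℝ) {Λ : ℝ} (hΛ : 0 ≤ Λ) {x : E4} (hx : 0 < Kerr.radius a x) (w : E4) :
    bilin M a Λ x (vecW a x) w =
      -(delta M a Λ (Kerr.radius a x) / xi a Λ ^ 2) * omegaCovector a x w -
        tilt M a Λ (Kerr.radius a x) * rhoSq a x / xi a Λ * drCovector a x w := by
  have hr : Kerr.radius a x ≠ 0 := hx.ne'
  have hra : Kerr.radius a x ^ 2 + a ^ 2 ≠ 0 := by positivity
  have hρ : rhoSq a x ≠ 0 := (rhoSq_pos a hx).ne'
  have hΞ : xi a Λ ≠ 0 := (xi_pos hΛ a).ne'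
  have hΔ : deltaTheta a Λ x ≠ 0 := (deltaTheta_pos a hΛ x).ne'
  rw [bilin_apply, angularBilin_apply, omegaCovector_vecW a hx, drCovector_vecW a x, sigma_vecW a hx,
    spatialDelta_vecW a x w, (vecW_apply a x).1]
  unfold sigmaCoeff
  unfold rhoSq sinSq deltaTheta xi at *
  field_simp
  ring

/-- **Frame lemma** `g(∂_r, w) = −(f/Ξ) ω(w) + ρ² q̂ dr(w)` (`Λ ≥ 0`, `r > 0`): `∂_r` is orthogonal
to the angular part. Petersen–Vasy (1.8). [cite: PetersenVasy2021, (1.8)] -/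
theorem bilin_vecR (M a : ℝ) {Λ : ℝ} (hΛ : 0 ≤ Λ) {x : E4} (hx : 0 < Kerr.radius a x) (w : E4) :
    bilin M a Λ x (vecR a x) w =
      -(tilt M a Λ (Kerr.radius a x) / xi a Λ) * omegaCovector a x w +
        rhoSq a x * radialCoeff M a Λ (Kerr.radius a x) * drCovector a x w := by
  have hr : Kerr.radius a x ≠ 0 := hx.ne'
  have hra : Kerr.radius a x ^ 2 + a ^ 2 ≠ 0 := by positivity
  have hρ : rhoSq a x ≠ 0 := (rhoSq_pos a hx).ne'
  have hΞ : xi a Λ ≠ 0 := (xi_pos hΛ a).ne'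
  have hΔ : deltaTheta a Λ x ≠ 0 := (deltaTheta_pos a hΛ x).ne'
  rw [bilin_apply, angularBilin_apply, omegaCovector_vecR a x, drCovector_vecR a hx, sigma_vecR a x,
    spatialDelta_vecR a hx w, (vecR_apply a x).1]
  field_simp
  ring

/-- **Frame lemma** `g(V₃, w) = (Δ_θ/Ξ²) σ(w) − (Δ_θ a sin²θ/Ξ²) w⁰` (`Λ ≥ 0`, `r > 0`).
Hintz–Vasy 2018, (3.13)–(3.14). [cite: HintzVasy2018, §3.2 (3.14)] -/
theorem bilin_vecV (M a : ℝ) {Λ : ℝ} (hΛ : 0 ≤ Λ) {x : E4} (hx : 0 < Kerr.radius a x) (w : E4) :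
    bilin M a Λ x (vecV a x) w =
      deltaTheta a Λ x / xi a Λ ^ 2 * E4.sigma x w -
        deltaTheta a Λ x * a * sinSq a x / xi a Λ ^ 2 * w 0 := by
  have hr : Kerr.radius a x ≠ 0 := hx.ne'
  have hra : Kerr.radius a x ^ 2 + a ^ 2 ≠ 0 := by positivity
  have hρ : rhoSq a x ≠ 0 := (rhoSq_pos a hx).ne'
  have hΞ : xi a Λ ≠ 0 := (xi_pos hΛ a).ne'
  have hΔ : deltaTheta a Λ x ≠ 0 := (deltaTheta_pos a hΛ x).ne'
  rw [bilin_apply, angularBilin_apply, omegaCovector_vecV a hx, drCovector_vecV a x, sigma_vecV a hx,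
    spatialDelta_vecV a x w, (vecV_apply a x).1]
  unfold sigmaCoeff
  unfold rhoSq sinSq deltaTheta xi at *
  field_simp
  ring

/-- `T = (1/ρ²)[Ξ² q̂ (r²+a²) W + Ξ f (r²+a²) ∂_r − (Ξ² a/Δ_θ) V₃]` (the definition of
`timeVector`, regrouped; Hintz–Vasy 2018, (3.14)). [cite: HintzVasy2018, §3.2 (3.14)] -/
theorem timeVector_eq_frame (M a Λ : ℝ) (x : E4) :
    timeVector M a Λ x =
      (rhoSq a x)⁻¹ •
        ((xi a Λ ^ 2 * radialCoeff M a Λ (Kerr.radius a x) * (Kerr.radius a x ^ 2 + a ^ 2)) • vecW a x +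
          (xi a Λ * tilt M a Λ (Kerr.radius a x) * (Kerr.radius a x ^ 2 + a ^ 2)) • vecR a x -
          (xi a Λ ^ 2 * a / deltaTheta a Λ x) • vecV a x) := by
  ext i
  fin_cases i
  · simp [timeVector, vecW, vecR, vecV]; ring
  · simp [timeVector, vecW, vecR, vecV]; ring
  · simp [timeVector, vecW, vecR, vecV]; ring
  · simp [timeVector, vecW, vecR, vecV]; ring

/-- **Discharge of the named fact `bilin_timeVector`**: `g(T, w) = −w⁰` wherever `Λ ≥ 0`, `r > 0`,
`R > 0`, from the frame lemmas and `f² + q̂Δ_r = 1` (`tilt_sq_add`):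
`ρ² g(T, w) = −(r²+a²)(q̂Δ_r + f²) ω(w) − a σ(w) + a² sin²θ w⁰ = −ρ² w⁰`.
Hintz–Vasy 2018, (3.14). [cite: HintzVasy2018, §3.2 (3.14)] -/
theorem bilin_timeVector_holds (M a Λ : ℝ) : bilin_timeVector M a Λ := by
  intro hΛ x hx hR w
  have hr : Kerr.radius a x ≠ 0 := hx.ne'
  have hra : Kerr.radius a x ^ 2 + a ^ 2 ≠ 0 := by positivity
  have hρ : rhoSq a x ≠ 0 := (rhoSq_pos a hx).ne'
  have hΞ : xi a Λ ≠ 0 := (xi_pos hΛ a).ne'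
  have hΔ : deltaTheta a Λ x ≠ 0 := (deltaTheta_pos a hΛ x).ne'
  have hrel : radialCoeff M a Λ (Kerr.radius a x) * delta M a Λ (Kerr.radius a x) +
      tilt M a Λ (Kerr.radius a x) ^ 2 = 1 := by
    linarith [tilt_sq_add (M := M) hΛ hra hR]
  have eq1 : bilin M a Λ x (timeVector M a Λ x) w =
      (rhoSq a x)⁻¹ *
        (-(Kerr.radius a x ^ 2 + a ^ 2) *
            (radialCoeff M a Λ (Kerr.radius a x) * delta M a Λ (Kerr.radius a x) +
              tilt M a Λ (Kerr.radius a x) ^ 2) * omegaCovector a x w -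
          a * E4.sigma x w + a ^ 2 * sinSq a x * w 0) := by
    rw [timeVector_eq_frame M a Λ x, map_smul, map_sub, map_add, map_smul, map_smul, map_smul]
    simp only [smul_apply, sub_apply, add_apply, smul_eq_mul]
    rw [bilin_vecW M a hΛ hx w, bilin_vecR M a hΛ hx w, bilin_vecV M a hΛ hx w]
    field_simp
    ring
  rw [eq1, hrel, omegaCovector_apply, E4.sigma_apply]
  unfold rhoSq sinSq at *
  field_simp
  ring

end Frame

/-! ### The slice and the smooth metric -/

/-- The **Kerr–de Sitter star-chart slice** `{t* = 0} ∩ {r > max r₀ 0}`: as an open subset of `E3`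
it is literally the Kerr–Schild slice `Kerr.slice a r₀` (same Cartesian coordinates, same radius
function `Kerr.radius a`); an `abbrev`, so that all of the `Kerr.slice` API (`Kerr.mem_slice`,
`Kerr.sliceEmbed`, `Kerr.afEnd`, the `ConnectedSpace` instance under `[Kerr.SliceFacts]`) applies.
Hintz–Vasy 2018, §3.2 (`X ⊂ ℝ³`, `Σ_{t*} = {t*} × X`). [cite: HintzVasy2018, §3.2] -/
abbrev slice (a r₀ : ℝ) : Opens E3 := Kerr.slice a r₀

/-- The Kerr–de Sitter metric regarded as a `C^∞` Lorentzian metric (`(metric M a Λ r₀ h).ofLE le_top`),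
the regularity at which `InitialDataSet` and developments are stated; by `rfl` the metric of
`KerrDeSitter.spacetime M a Λ r₀ h`. Carter 1968; Hintz–Vasy 2018, §3.2. [cite: HintzVasy2018, §3.2] -/
abbrev smoothMetric [Facts] (M a Λ r₀ : ℝ) (h : IsRegular M a Λ r₀) :
    LorentzianMetric 𝓘(ℝ, E4) ∞ (Kerr.region a r₀) :=
  (metric M a Λ r₀ h).ofLE le_top

/-- The metric of `KerrDeSitter.spacetime M a Λ r₀ h` is `smoothMetric M a Λ r₀ h` (by `rfl`).
Hintz–Vasy 2018, §3.2. [cite: HintzVasy2018, §3.2] -/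
theorem spacetime_metric [Kerr.Facts] [Facts] (M a Λ r₀ : ℝ) (h : IsRegular M a Λ r₀) :
    (spacetime M a Λ r₀ h).metric = smoothMetric M a Λ r₀ h := rfl

/-- At `Λ = 0` the Kerr–de Sitter metric **is** the Kerr metric of `KerrSchild.lean` (as bundled
analytic Lorentzian metrics on `Kerr.region a r₀`; from `bilin_zero_lambda`). Dafermos–Rodnianski
arXiv:0811.0354, §5.1. [cite: arXiv08110354, §5.1] -/
theorem metric_zero_lambda [Kerr.Facts] [Facts] (M a r₀ : ℝ) (h : IsRegular M a 0 r₀) :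
    metric M a 0 r₀ h = Kerr.metric M a r₀ := by
  have hP : (metric M a 0 r₀ h).toPseudoRiemannianMetric =
      (Kerr.metric M a r₀).toPseudoRiemannianMetric := by
    ext x : 2
    exact bilin_zero_lambda M a (Kerr.radius_pos_of_mem_region x.2)
  cases hK : Kerr.metric M a r₀ with
  | mk toP ex pos =>
    cases hD : metric M a 0 r₀ h with
    | mk toP' ex' pos' =>
      rw [hK, hD] at hP
      cases hP
      rfl

/-- At `Λ = 0` the smooth Kerr–de Sitter metric is `Kerr.smoothMetric M a r₀`
(Dafermos–Rodnianski arXiv:0811.0354, §5.1). [cite: arXiv08110354, §5.1] -/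
theorem smoothMetric_zero_lambda [Kerr.Facts] [Facts] (M a r₀ : ℝ) (h : IsRegular M a 0 r₀) :
    smoothMetric M a 0 r₀ h = Kerr.smoothMetric M a r₀ := by
  rw [smoothMetric, metric_zero_lambda]

/-! ### The future unit normal and the second fundamental form -/

/-- The **future unit normal** of the slice `{t* = 0}`: `ν = T/√(T⁰)` at `(0, y)`, where
`T = −g♯(dt*) = KerrDeSitter.timeVector` and `T⁰ = dt*(T) = −g(T, T) = (Q − Ξ²a² sin²θ/Δ_θ)/ρ² > 0`
for regular parameters (so `g(ν, ν) = −1`, `g(ν, dι v) = −(dι v)⁰/√T⁰ = 0`). At `Λ = 0` it is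
`Kerr.sliceNormal` (`sliceNormal_zero_lambda`: `T⁰ = 1 + 2H`). **Junk value** where `T⁰ ≤ 0`
(`Real.sqrt`, `0⁻¹ = 0`). Hintz–Vasy 2018, §3.5 (future unit normal of `Σ₀`); Cook 2000, §3.2.2
(`Λ = 0`: lapse `(1 + 2H)^{-1/2}`). [cite: HintzVasy2018, §3.5] -/
def sliceNormal (M a Λ r₀ : ℝ) : NormalField 𝓘(ℝ, E4) (Kerr.sliceEmbed a r₀) :=
  fun y ↦ (√(timeVector M a Λ (E4.ofTimeSpace 0 y) 0))⁻¹ • timeVector M a Λ (E4.ofTimeSpace 0 y)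

/-- Unfolding lemma for `KerrDeSitter.sliceNormal` (Hintz–Vasy 2018, §3.5). [cite: HintzVasy2018, §3.5] -/
theorem sliceNormal_apply (M a Λ r₀ : ℝ) (y : Kerr.slice a r₀) :
    sliceNormal M a Λ r₀ y =
      (√(timeVector M a Λ (E4.ofTimeSpace 0 y) 0))⁻¹ • timeVector M a Λ (E4.ofTimeSpace 0 y) :=
  rfl

/-- `dt*(T) = 1 + 2H` for the Kerr–Schild time vector (Dafermos–Rodnianski arXiv:0811.0354, §5.1:
`g^{t*t*} = −1 − 2H`). [cite: arXiv08110354, §5.1] -/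
theorem _root_.Literature.Geometry.Lorentzian.Kerr.timeVector_apply_zero (M a : ℝ) (x : E4) :
    Kerr.timeVector M a x 0 = 1 + 2 * Kerr.scalarH M a x := by
  simp [Kerr.timeVector, Kerr.nullVector, Kerr.nullCovectorFun]

/-- At `Λ = 0` the unit normal is the Kerr–Schild one, `ν = (1 + 2H)^{-1/2} (1 + 2H, −2H ℓ⃗)`
(Cook 2000, §3.2.2). [cite: Cook2000, §3.2.2] -/
theorem sliceNormal_zero_lambda (M a r₀ : ℝ) : sliceNormal M a 0 r₀ = Kerr.sliceNormal M a r₀ := by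
  funext y
  have hx : 0 < Kerr.radius a (E4.ofTimeSpace 0 y) := Kerr.radius_pos_of_mem_region y.2
  rw [sliceNormal_apply, Kerr.sliceNormal_apply, timeVector_zero_lambda M a hx,
    Kerr.timeVector_apply_zero]

section SecondFundamentalForm

variable [Facts]

/-- The **second fundamental form of the Kerr–de Sitter slice** at `y`, as a continuous bilinear
form on `T_y (Kerr.slice a r₀) = E3`: the image under `LinearMap.toContinuousBilinearMap` of
`secondFundamentalForm 𝓘(ℝ, E3) g (Kerr.sliceEmbed a r₀) (sliceNormal M a Λ r₀) y`, i.e.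
`k(v, w) = + g(D_v ν, dι w)` with the future unit normal (sign convention (h); Wald (10.2.13)).
For a stationary metric in lapse–shift form this is `(ℒ_β h)/(2N)`. Standing hypotheses as for
`Kerr.sliceK`: `[KerrDeSitter.Facts]`, `h : IsRegular …` and `[(smoothMetric M a Λ r₀ h).HasLeviCivita]`
(supplied by `hasLeviCivita_smoothMetric` under `[KerrDeSitter.SliceFacts]`). Hintz–Vasy 2018, §2.1
and §3.5 (the data `(h, k)` induced on `Σ₀`). [cite: HintzVasy2018, §3.5] -/
def sliceK (M a Λ r₀ : ℝ) (h : IsRegular M a Λ r₀) [(smoothMetric M a Λ r₀ h).HasLeviCivita]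
    (y : Kerr.slice a r₀) :
    TangentSpace 𝓘(ℝ, E3) y →L[ℝ] TangentSpace 𝓘(ℝ, E3) y →L[ℝ] ℝ :=
  show E3 →L[ℝ] E3 →L[ℝ] ℝ from
    LinearMap.toContinuousBilinearMap
      (show E3 →ₗ[ℝ] E3 →ₗ[ℝ] ℝ from
        (smoothMetric M a Λ r₀ h).secondFundamentalForm 𝓘(ℝ, E3) (Kerr.sliceEmbed a r₀)
          (sliceNormal M a Λ r₀) y)

/-- `KerrDeSitter.sliceK` is the second fundamental form `K_ν` of `Hypersurface.lean` (by `rfl`).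
Wald 1984, (10.2.13). [cite: Wald1984, (10.2.13)] -/
@[simp]
theorem sliceK_apply (M a Λ r₀ : ℝ) (h : IsRegular M a Λ r₀) [(smoothMetric M a Λ r₀ h).HasLeviCivita]
    (y : Kerr.slice a r₀) (v w : TangentSpace 𝓘(ℝ, E3) y) :
    sliceK M a Λ r₀ h y v w =
      (smoothMetric M a Λ r₀ h).secondFundamentalForm 𝓘(ℝ, E3) (Kerr.sliceEmbed a r₀)
        (sliceNormal M a Λ r₀) y v w :=
  rfl

/-! ### Spacelikeness of the slice, the future unit normal, and the named facts -/

omit [Facts] in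
/-- `T⁰ = dt*(T) = (Q − Ξ²a² sin²θ/Δ_θ)/ρ² > 0` on the chart domain for regular parameters
(`Q > Ξ²a² ≥ Ξ²a² sin²θ/Δ_θ`); by `g(T, ·) = −dt*` this is `−g(T, T)`. Petersen–Vasy
arXiv:2112.01355, Remark 1.1. [cite: PetersenVasy2021, Remark 1.1] -/
theorem timeVector_apply_zero_pos {M a Λ r₀ : ℝ} (h : IsRegular M a Λ r₀) {x : E4}
    (hx : x ∈ Kerr.region a r₀) : 0 < timeVector M a Λ x 0 := by
  have hr0 : 0 < Kerr.radius a x := Kerr.radius_pos_of_mem_region hx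
  have hρ : 0 < rhoSq a x := rhoSq_pos a hr0
  have hΔθ : 0 < deltaTheta a Λ x := deltaTheta_pos a h.lambda_nonneg x
  have hQ := h.lt_lapseFn hx
  have hs : sinSq a x ≤ 1 := by
    unfold sinSq
    have : 0 ≤ x 3 ^ 2 / Kerr.radius a x ^ 2 := by positivity
    linarith
  have hΔθ1 : 1 ≤ deltaTheta a Λ x := by
    unfold deltaTheta
    have : 0 ≤ Λ / 3 * a ^ 2 * x 3 ^ 2 / Kerr.radius a x ^ 2 := by
      have := h.lambda_nonneg; positivity
    linarith
  have hT0 : timeVector M a Λ x 0 =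
      (xi a Λ ^ 2 * radialCoeff M a Λ (Kerr.radius a x) * (Kerr.radius a x ^ 2 + a ^ 2) ^ 2 -
        xi a Λ ^ 2 * a ^ 2 * sinSq a x / deltaTheta a Λ x) / rhoSq a x := by
    simp [timeVector]
  rw [hT0]
  refine div_pos ?_ hρ
  have hq : xi a Λ ^ 2 * radialCoeff M a Λ (Kerr.radius a x) * (Kerr.radius a x ^ 2 + a ^ 2) ^ 2 =
      lapseFn M a Λ (Kerr.radius a x) := by
    unfold radialCoeff lapseFn
    field_simp
  rw [hq]
  have h1 : xi a Λ ^ 2 * a ^ 2 * sinSq a x / deltaTheta a Λ x ≤ xi a Λ ^ 2 * a ^ 2 := by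
    rw [div_le_iff₀ hΔθ]
    have h0 : 0 ≤ xi a Λ ^ 2 * a ^ 2 := by positivity
    nlinarith
  linarith

omit [Facts] in
/-- `g(T, T) = −T⁰` on the chart domain for regular parameters (`g(T, ·) = −dt*`,
`bilin_timeVector_holds`). Hintz–Vasy 2018, (3.14). [cite: HintzVasy2018, §3.2 (3.14)] -/
theorem bilin_timeVector_timeVector {M a Λ r₀ : ℝ} (h : IsRegular M a Λ r₀) {x : E4}
    (hx : x ∈ Kerr.region a r₀) :
    bilin M a Λ x (timeVector M a Λ x) (timeVector M a Λ x) = -timeVector M a Λ x 0 :=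
  bilin_timeVector_holds M a Λ h.lambda_nonneg x (Kerr.radius_pos_of_mem_region hx)
    (h.tiltNormSq_pos hx) _

omit [Facts] in
/-- `T` is `g`-orthogonal to the slice `{t* = 0}`: `g(T, (0, v)) = 0` (`g(T, ·) = −dt*`).
Hintz–Vasy 2018, §3.3. [cite: HintzVasy2018, §3.3] -/
theorem bilin_timeVector_ofTimeSpace {M a Λ r₀ : ℝ} (h : IsRegular M a Λ r₀) {x : E4}
    (hx : x ∈ Kerr.region a r₀) (v : E3) :
    bilin M a Λ x (timeVector M a Λ x) (E4.ofTimeSpace 0 v) = 0 := by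
  rw [bilin_timeVector_holds M a Λ h.lambda_nonneg x (Kerr.radius_pos_of_mem_region hx)
    (h.tiltNormSq_pos hx), E4.ofTimeSpace_apply_zero, neg_zero]

/-- For regular parameters the slice embedding `y ↦ (0, y)` is a **spacelike immersion** into
`(Kerr.region a r₀, g_{M,a,Λ})`: `(0, v)` is `g`-orthogonal to the timelike vector `T = −g♯(dt*)`
(`bilin_timeVector_holds`, `bilin_timeVector_timeVector_neg`), hence spacelike by the Lorentzian
signature (`[KerrDeSitter.Facts]`). Petersen–Vasy arXiv:2112.01355, Remark 1.1, (1.9); Hintz–Vasy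
2018, §3.3 (`dt*` is timelike everywhere). [cite: PetersenVasy2021, Remark 1.1] -/
theorem isSpacelikeImmersion_sliceEmbed (M a Λ r₀ : ℝ) (h : IsRegular M a Λ r₀) :
    (smoothMetric M a Λ r₀ h).IsSpacelikeImmersion 𝓘(ℝ, E3) (Kerr.sliceEmbed a r₀) := by
  refine ⟨Kerr.contMDiff_sliceEmbed a r₀ _, fun y v hv ↦ ?_⟩
  have hy : E4.ofTimeSpace 0 (y : E3) ∈ Kerr.region a r₀ := y.2
  rw [PseudoRiemannianMetric.inducedBilin_apply, Kerr.mfderiv_sliceEmbed_apply]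
  have hne : E4.ofTimeSpace 0 v ≠ 0 := fun h0 ↦ hv (by
    have := congrArg E4.spatial h0
    rwa [E4.spatial_ofTimeSpace, map_zero] at this)
  exact (Facts.isLorentzian_bilin M a Λ r₀ h _ hy).2.2 _ _ (bilin_timeVector_timeVector_neg h hy)
    (bilin_timeVector_ofTimeSpace h hy v) hne

/-- For regular parameters `KerrDeSitter.sliceNormal` is the **future unit normal** of the slice
embedding in the time-oriented star-chart: `g(ν, dι v) = 0` and `g(ν, ν) = −1` (from
`g(T, ·) = −dt*`, `T⁰ = −g(T, T) > 0`), and `g(T, ν) < 0`. Hintz–Vasy 2018, §3.5; Wald 1984,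
§10.2. [cite: HintzVasy2018, §3.5] -/
theorem isFutureUnitNormal_sliceNormal (M a Λ r₀ : ℝ) (h : IsRegular M a Λ r₀) :
    (smoothMetric M a Λ r₀ h).IsFutureUnitNormal 𝓘(ℝ, E3) ((timeOrientation M a Λ r₀ h).ofLE le_top)
      (Kerr.sliceEmbed a r₀) (sliceNormal M a Λ r₀) := by
  have key : ∀ y : Kerr.slice a r₀, ∀ w : E4,
      (smoothMetric M a Λ r₀ h).val (Kerr.sliceEmbed a r₀ y) (sliceNormal M a Λ r₀ y) w =
        (√(timeVector M a Λ (E4.ofTimeSpace 0 y) 0))⁻¹ *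
          bilin M a Λ (E4.ofTimeSpace 0 y) (timeVector M a Λ (E4.ofTimeSpace 0 y)) w := by
    intro y w
    show bilin M a Λ (E4.ofTimeSpace 0 y)
        ((√(timeVector M a Λ (E4.ofTimeSpace 0 y) 0))⁻¹ • timeVector M a Λ (E4.ofTimeSpace 0 y)) w = _
    rw [map_smul, smul_apply, smul_eq_mul]
  have hpos : ∀ y : Kerr.slice a r₀, 0 < timeVector M a Λ (E4.ofTimeSpace 0 y) 0 := fun y ↦
    timeVector_apply_zero_pos h y.2
  have hself : ∀ y : Kerr.slice a r₀,
      (smoothMetric M a Λ r₀ h).val (Kerr.sliceEmbed a r₀ y) (sliceNormal M a Λ r₀ y)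
        (sliceNormal M a Λ r₀ y) = -1 := by
    intro y
    rw [key, sliceNormal_apply, map_smul, smul_eq_mul, bilin_timeVector_timeVector h y.2]
    have hs : √(timeVector M a Λ (E4.ofTimeSpace 0 y) 0) ^ 2 = timeVector M a Λ (E4.ofTimeSpace 0 y) 0 :=
      Real.sq_sqrt (hpos y).le
    have hs0 : √(timeVector M a Λ (E4.ofTimeSpace 0 y) 0) ≠ 0 := (Real.sqrt_pos.2 (hpos y)).ne'
    field_simp
    linarith [hs]
  refine ⟨⟨fun y v ↦ ?_, hself⟩, fun y ↦ ⟨⟨by rw [hself y]; norm_num, fun h0 ↦ ?_⟩, ?_⟩⟩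
  · rw [key, Kerr.mfderiv_sliceEmbed_apply, bilin_timeVector_ofTimeSpace h y.2, mul_zero]
  · have := hself y
    rw [h0, map_zero] at this
    norm_num at this
  · show (smoothMetric M a Λ r₀ h).val (Kerr.sliceEmbed a r₀ y) (timeVector M a Λ (E4.ofTimeSpace 0 y))
        (sliceNormal M a Λ r₀ y) < 0
    rw [(smoothMetric M a Λ r₀ h).symm, key, bilin_timeVector_timeVector h y.2]
    have hc : 0 < (√(timeVector M a Λ (E4.ofTimeSpace 0 y) 0))⁻¹ :=
      inv_pos.2 (Real.sqrt_pos.2 (hpos y))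
    nlinarith [hpos y]

/-- For regular parameters the second fundamental form of the Kerr–de Sitter slice is symmetric
(`ν` is a genuine smooth unit normal; `secondFundamentalForm_symm`). O'Neill 1983, Ch. 4,
Lemma 4.4; Wald 1984, §10.2. Named fact (D-0014; the Levi-Civita hypothesis is an inner binder),
a field of `KerrDeSitter.SliceFacts`. [cite: ONeill1983, Ch. 4 Lemma 4.4] -/
def sliceK_symm (M a Λ r₀ : ℝ) : Prop :=
  ∀ (h : IsRegular M a Λ r₀) [(smoothMetric M a Λ r₀ h).HasLeviCivita] (y : Kerr.slice a r₀)
    (v w : TangentSpace 𝓘(ℝ, E3) y), sliceK M a Λ r₀ h y v w = sliceK M a Λ r₀ h y w v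

/-- For regular parameters `y ↦ k_y` is a smooth section of the bundle of bilinear forms on
`T(Kerr.slice a r₀)` (its components are analytic functions of `(y, r, √R)` with nonvanishing
denominators). Hintz–Vasy 2018, Prop. 3.5 and §3.5. Named fact (D-0014), a field of
`KerrDeSitter.SliceFacts`. [cite: HintzVasy2018, Prop. 3.5] -/
def contMDiff_sliceK (M a Λ r₀ : ℝ) : Prop :=
  ∀ (h : IsRegular M a Λ r₀) [(smoothMetric M a Λ r₀ h).HasLeviCivita],
    ContMDiff 𝓘(ℝ, E3) (𝓘(ℝ, E3).prod 𝓘(ℝ, E3 →L[ℝ] E3 →L[ℝ] ℝ)) ∞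
      (fun y : Kerr.slice a r₀ ↦ TotalSpace.mk' (E3 →L[ℝ] E3 →L[ℝ] ℝ)
        (E := fun x : Kerr.slice a r₀ ↦
          TangentSpace 𝓘(ℝ, E3) x →L[ℝ] TangentSpace 𝓘(ℝ, E3) x →L[ℝ] ℝ)
        y (sliceK M a Λ r₀ h y))

/-- The analytic facts about the Kerr–de Sitter slice `{t* = 0}` vendored as named facts (D-0014)
and on which the bundled initial data set `KerrDeSitter.data` depends: existence of the Levi-Civita
connection of the smooth metric (generic named fact `isCovariantDerivativeOn_leviCivitaFun`,
O'Neill 1983, Ch. 3, Thm. 3.11) and symmetry and smoothness of `k` (Hintz–Vasy 2018, §3.5);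
spacelikeness of the slice and the future-unit-normal property of `sliceNormal` are *theorems*
here (`isSpacelikeImmersion_sliceEmbed`, `isFutureUnitNormal_sliceNormal`), and connectedness of
the slice and smoothness of pullbacks are the fields of `Kerr.SliceFacts` (same slice, same
region). A `Prop`-valued class taken as the instance hypothesis
`[KerrDeSitter.SliceFacts]` (house pattern `Kerr.SliceFacts`). [cite: HintzVasy2018, §3.5] -/
class SliceFacts [Facts] : Prop where
  /-- The Levi-Civita formula of the smooth Kerr–de Sitter metric is a covariant derivative. -/
  isCovariantDerivativeOn_leviCivitaFun (M a Λ r₀ : ℝ) (h : IsRegular M a Λ r₀) :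
    (smoothMetric M a Λ r₀ h).isCovariantDerivativeOn_leviCivitaFun
  /-- `k` is symmetric (named fact `sliceK_symm`). -/
  sliceK_symm (M a Λ r₀ : ℝ) : KerrDeSitter.sliceK_symm M a Λ r₀
  /-- `y ↦ k_y` is smooth (named fact `contMDiff_sliceK`). -/
  contMDiff_sliceK (M a Λ r₀ : ℝ) : KerrDeSitter.contMDiff_sliceK M a Λ r₀

/-- The smooth Kerr–de Sitter metric carries its Levi-Civita connection (standing hypothesis
`[(smoothMetric M a Λ r₀ h).HasLeviCivita]`), from the field of `[KerrDeSitter.SliceFacts]` via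
`HasLeviCivita.of`. O'Neill 1983, Ch. 3, Thm. 3.11. [cite: ONeill1983, Ch. 3 Thm. 3.11] -/
instance hasLeviCivita_smoothMetric [SliceFacts] (M a Λ r₀ : ℝ) (h : IsRegular M a Λ r₀) :
    (smoothMetric M a Λ r₀ h).HasLeviCivita :=
  PseudoRiemannianMetric.HasLeviCivita.of _ (SliceFacts.isCovariantDerivativeOn_leviCivitaFun M a Λ r₀ h)

/-! ### The initial data set -/

/-- The **Kerr–de Sitter initial data set** `(KerrDeSitter.slice a r₀, h, k)` induced by
`g_{M,a,Λ}` on the horizon-crossing star-chart slice `{t* = 0} ∩ {r > max r₀ 0}` for regular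
parameters `h : IsRegular M a Λ r₀`: `h = ι^* g` (`inducedRiemannianMetric`, pullback-smoothness from
`[Kerr.SliceFacts]`) and `k = K_ν`, the second fundamental form w.r.t. the **future** unit normal
`ν = KerrDeSitter.sliceNormal` (sign `K_ν(v, w) = +g(D_v ν, dι w)`). For subextremal parameters
and `r₋ < r₀ < r₊` the slice crosses the future event horizon and the future cosmological horizon
and reaches the conformal boundary of the expanding region; `Λ = 0` gives the Kerr–Schild slice
data of `Kerr.data` (same slice, `smoothMetric_zero_lambda`, `sliceNormal_zero_lambda`), `a = 0`
Schwarzschild–de Sitter, `M = 0` de Sitter data. Hintz–Vasy 2018, §3.5 (geometric data on `Σ₀`);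
Fang arXiv:2112.07183; Petersen–Vasy arXiv:2112.01355, §1.1. [cite: HintzVasy2018, §3.5] -/
def data [Kerr.SliceFacts] [SliceFacts] (M a Λ r₀ : ℝ) (h : IsRegular M a Λ r₀) :
    InitialDataSet 𝓘(ℝ, E3) (slice a r₀) where
  h := (smoothMetric M a Λ r₀ h).inducedRiemannianMetric (Kerr.sliceEmbed a r₀)
    (Kerr.SliceFacts.contMDiff_pullbackBilin a r₀)
    (isSpacelikeImmersion_sliceEmbed M a Λ r₀ h)
  k := sliceK M a Λ r₀ h
  k_symm := SliceFacts.sliceK_symm M a Λ r₀ h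
  contMDiff_k := SliceFacts.contMDiff_sliceK M a Λ r₀ h

/-- The metric of the Kerr–de Sitter data at `y` is the induced form `g((0, v), (0, w))` at
`(0, y)` (Hintz–Vasy 2018, §3.5). [cite: HintzVasy2018, §3.5] -/
@[simp]
theorem data_h_inner [Kerr.SliceFacts] [SliceFacts] (M a Λ r₀ : ℝ) (h : IsRegular M a Λ r₀)
    (y : Kerr.slice a r₀) :
    (data M a Λ r₀ h).h.inner y =
      (smoothMetric M a Λ r₀ h).inducedBilin 𝓘(ℝ, E3) (Kerr.sliceEmbed a r₀) y :=
  rfl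

/-- The tensor `k` of the Kerr–de Sitter data is `KerrDeSitter.sliceK` (Hintz–Vasy 2018, §3.5). [cite: HintzVasy2018, §3.5] -/
@[simp]
theorem data_k [Kerr.SliceFacts] [SliceFacts] (M a Λ r₀ : ℝ) (h : IsRegular M a Λ r₀) :
    (data M a Λ r₀ h).k = sliceK M a Λ r₀ h := rfl

/-- At `Λ = 0` the metric of the Kerr–de Sitter data is that of `Kerr.data`: both are the pullback
of the same values `g_{M,a}(0, y)` along `y ↦ (0, y)` (`bilin_zero_lambda`). Cook 2000, §3.2.2
(`h = δ + 2H ℓ⃗ ⊗ ℓ⃗`). [cite: Cook2000, §3.2.2] -/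
theorem data_h_inner_zero_lambda [Kerr.Facts] [Kerr.SliceFacts] [SliceFacts] (M a r₀ : ℝ)
    (h : IsRegular M a 0 r₀) (hM : 0 ≤ M) (y : Kerr.slice a r₀) :
    (data M a 0 r₀ h).h.inner y = (Kerr.data M a r₀ hM).h.inner y := by
  rw [data_h_inner, Kerr.data_h_inner, smoothMetric_zero_lambda]

/-- The Kerr–de Sitter data solve the **`Λ`-vacuum constraint equations**: at every point of the
slice the Hamiltonian constraint function `R(h) − |k|²_h + (tr_h k)²` equals `2Λ` and the momentum
constraint covector `div_h k − d(tr_h k)` vanishes (Gauss–Codazzi for a spacelike slice of the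
Einstein metric `Ric = Λ g`, `isEinsteinVacuum`: `2G(ν,ν) = −2Λ g(ν,ν) = 2Λ`, `G(ν, ·)|_{TΣ} = 0`).
Hintz–Vasy 2018, (2.3)–(2.4) and §3.5; Choquet-Bruhat 2009, Ch. VI, Thm. 3.3 and Ch. VII.
Named fact (D-0014); `h : IsRegular …` is the leading binder and it binds the standing hypothesis
`[(data …).metric.HasLeviCivita]` of the constraint functions, as `Kerr.data_isVacuumConstraintSolution`
does. [cite: HintzVasy2018, §2.1 (2.3)–(2.4)] -/
def data_isConstraintSolution [Kerr.SliceFacts] [SliceFacts] (M a Λ r₀ : ℝ) : Prop :=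
  ∀ (h : IsRegular M a Λ r₀) [(data M a Λ r₀ h).metric.HasLeviCivita] (y : Kerr.slice a r₀),
    (data M a Λ r₀ h).hamiltonianConstraintFn y = 2 * Λ ∧ (data M a Λ r₀ h).momentumConstraintFn y = 0

end SecondFundamentalForm

end KerrDeSitter

end Literature.Geometry.Lorentzian

end
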